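import Summits.HodgeConjecture.HodgeConjecture.Theorems.EightfoldBlochSeedsBlochSeedsGenericRegularImmersionOfSmoothSubscheme
import Summits.HodgeConjecture.HodgeConjecture.Theorems.EightfoldBlochSeedsBlochSeedsGenericPad4CarrierStubOfKleimanSmoothing
import Summits.HodgeConjecture.HodgeConjecture.Theorems.EightfoldBlochSeedsBlochSeedDiscOnePad4CarrierOfDesign32
import Literature.AlgebraicGeometry.HodgeTheory.KleimanSmoothingCycles
import Literature.AlgebraicGeometry.Motives.AbstractHodgeTate
import HarnessLib

/-!
# Route `EightfoldBlochSeeds`, cruxes `BlochSeedsGeneric` / `BlochSeedDiscThree` (items stmt-HodgeConjecture-18880 / 18882),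
# stub `stub_pad4_carrier`: the named fact (K) `kleiman1969_smoothingCycles_eightfold_codimFour` FOLLOWS FROM ITS SMOOTH FORM
# — the local-complete-intersection clause `IsRegularImmersionOfCodim i 4` is DISCHARGED (EGA IV 17.12.1, this hand's K5 files)

HONEST FRAMING. CONDITIONAL `--supports` helpers: hypothesis = the SMOOTH FORM of Kleiman's smoothing statement (below, verbatim
(K) with «`IsRegularImmersionOfCodim i 4 ∧ Smooth (i ≫ X.hom)`» replaced by «`IsClosedImmersion i ∧ SmoothOfRelativeDimension 4
(i ≫ X.hom)`»), still UNPROVED in the tree (no Chern classes in Betti cohomology, no Thom–Porteous / Kleiman–Bertini /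
Fulton–Lazarsfeld: debts K1–K4 of the census). Nothing here proves the stub, (K), the crux, H2, HC_AV or HC. No definition, no
new named fact (D-0026): the smooth form is a HYPOTHESIS SHAPE written inline, not a `def`.

WHAT (leafhand `leafhand-hodge-eightfoldblochseed-1-g3`). Kleiman's degeneracy locus `D` of `r - 3` general sections of a
globally generated rank-`r ≤ 8` bundle on the eightfold `X` is DETERMINANTAL — a local complete intersection ONLY because it is
smooth (deeper stratum of codimension `10 > 8`) inside the smooth `X`. The K5 chain of this hand
(`…RegularSequenceSpread` ▸ `…RegularImmersionOfStalks` ▸ `…RegularImmersionOfRegularSubscheme` ▸ `…RegularImmersionOfSmoothSubscheme`)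
makes that implication a tree theorem (`isRegularImmersionOfCodim_of_smoothOfRelativeDimension`), so:

* `kleiman1969_smoothingCycles_eightfold_codimFour_of_smoothForm` — SMOOTH FORM ⟹ (K) (`X` is irreducible by
  `IsSmoothProjective.irreducibleSpace`, `D` is integral — hence irreducible — by `isIntegral_of_smooth_of_connectedSpace`,
  `4 + 4 = 8`);
* `stub_pad4_carrier_of_kleimanSmoothForm`, `stub_pad4_carrier_discThree_of_kleimanSmoothForm` — the registered carrier stubs of
  18880 (every `d`) and 18882 (`d = 3`) IN THEIR OWN SIGNATURES modulo the smooth form (composition with 3-g1's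
  `stub_pad4_carrier_of_kleimanSmoothing`).

EXACT RESIDUAL of the carrier stubs after this file: the smooth form of (K) = Kleiman 1969 §5 / Fulton Ex. 15.3.2 (class
`(p-1)!·α + n·hᵖ = c_p(E)`, `E(-1)` globally generated: K1 Chern classes in `complexBetti` + K2 normal form) + Fulton Ex. 14.3.2 /
Kleiman–Bertini (degeneracy locus of general sections smooth of relative dimension `4`, class supported on it: K3) +
Fulton–Lazarsfeld Thm. 1.1 (b) (connected: K4).

[cite: Kleiman1969Grassmannians, §4–§5] [cite: Fulton1998, Example 15.3.2, Example 14.3.2 (b)(d), Example 14.4.13 and §19.1]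
[cite: FultonLazarsfeld1981, Thm. 1.1 (b)] [cite: EGAIV4, Prop. 17.12.1]
-/

noncomputable section

-- single-problem summit (Problem = Summit): the mandated namespace repeats `HodgeConjecture`.
set_option linter.dupNamespace false

open CategoryTheory AlgebraicGeometry
open Literature.AlgebraicGeometry Literature.AlgebraicGeometry.Motives Literature.AlgebraicGeometry.HodgeTheory
open Literature.AlgebraicTopology.SingularHomology
open Summit.HodgeConjecture.HodgeConjecture.Theorems.EightfoldBlochSeeds

namespace Summit.HodgeConjecture.HodgeConjecture.Theorems

section SmoothForm

/- The SMOOTH FORM of Kleiman's smoothing statement on a smooth projective eightfold in codimension four (hypothesis shape of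
this section, verbatim `kleiman1969_smoothingCycles_eightfold_codimFour` with the regular-immersion clause replaced by «closed
immersion, smooth of relative dimension `4` over `ℂ`»). -/
variable (hKS : ∀ (X : Motives.SchemeOver ℂ), Motives.IsSmoothProjective 8 X →
    ∀ (e : Motives.ProjectiveEmbedding X) (a : complexBetti (Motives.projectiveSpace e.n ℂ) 2),
      IsRationalClass a → a ≠ 0 →
    ∀ (y : complexBetti X (2 * 4)), IsRationalClass y → y ∈ algebraicClasses X 4 →
      ∃ (M : ℕ) (c : ℚ) (Z : AlgebraicGeometry.Scheme.{0}) (i : Z ⟶ X.left),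
        0 < M ∧ IsClosedImmersion i ∧ AlgebraicGeometry.SmoothOfRelativeDimension 4 (i ≫ X.hom) ∧ ConnectedSpace Z ∧
        ((M : ℕ) : ℂ) • y + ((c : ℚ) : ℂ) • cupPowTwo (complexBetti.map e.ι 2 a) 4 ∈
          classesSupportedOn X (Set.range i.base) (2 * 4))

include hKS

/-- **The smooth form of Kleiman's statement implies the named fact (K)** `kleiman1969_smoothingCycles_eightfold_codimFour`:
the extra clause `IsRegularImmersionOfCodim i 4` of (K) holds for every closed subscheme smooth of relative dimension `4` of
the smooth projective (irreducible) eightfold `X` which is connected (hence irreducible: smooth + connected ⟹ integral), by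
`isRegularImmersionOfCodim_of_smoothOfRelativeDimension` (EGA IV 17.12.1, `4 + 4 = 8`).
[cite: EGAIV4, Prop. 17.12.1] [cite: Kleiman1969Grassmannians, §5] [cite: Fulton1998, Example 15.3.2] -/
theorem kleiman1969_smoothingCycles_eightfold_codimFour_of_smoothForm :
    kleiman1969_smoothingCycles_eightfold_codimFour := by
  intro X hX e a ha ha0 y hy hyalg
  obtain ⟨M, c, Z, i, hM, hci, hsm, hconn, hsupp⟩ := hKS X hX e a ha ha0 y hy hyalg
  haveI := hci
  haveI := hsm
  haveI := hconn
  haveI : Smooth (i ≫ X.hom) := SmoothOfRelativeDimension.smooth 4 (i ≫ X.hom)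
  haveI : IrreducibleSpace X.left := hX.irreducibleSpace
  haveI : SmoothOfRelativeDimension 8 X.hom := hX.smoothOfRelativeDimension
  haveI : AlgebraicGeometry.IsIntegral Z := isIntegral_of_smooth_of_connectedSpace (i ≫ X.hom)
  exact ⟨M, c, Z, i, hM, isRegularImmersionOfCodim_of_smoothOfRelativeDimension X.hom i (show 4 + 4 = 8 by norm_num),
    inferInstance, hconn, hsupp⟩

/-- **`stub_pad4_carrier` of crux `BlochSeedsGeneric` (item 18880; every `d ≥ 1`, every CM datum) MODULO THE SMOOTH FORM of
Kleiman's statement**, in the stub's own signature (3-g1's `stub_pad4_carrier_of_kleimanSmoothing` ∘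
`kleiman1969_smoothingCycles_eightfold_codimFour_of_smoothForm`). [cite: Kleiman1969Grassmannians, §5]
[cite: Bloch1972Semiregularity, Remark (7.5)] -/
theorem stub_pad4_carrier_of_kleimanSmoothForm
    (d : ℕ) (hd : 0 < d) (E₀ : AbelianVariety ℂ) (ψ₀ : E₀ ⟶ E₀) (hE : E₀.dim = 1) (hψ : ψ₀ ≫ ψ₀ = -(d • 𝟙 E₀)) :
    ∃ (e : ProjectiveEmbedding (pad4Anchor E₀).X) (a : complexBetti (projectiveSpace e.n ℂ) 2)
      (w : complexBetti (pad4Anchor E₀).X (2 * 4)),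
      IsRationalClass a ∧ a ≠ 0 ∧
      w ∈ weilClassesOf (pad4Anchor E₀) (pad4Action E₀ ψ₀) 4 d ∧ IsRationalClass w ∧ w ≠ 0 ∧
      HasLciCarrierAt 4 (pad4Anchor E₀) (symH d (pad4Action E₀ ψ₀) e a) w :=
  stub_pad4_carrier_of_kleimanSmoothing (kleiman1969_smoothingCycles_eightfold_codimFour_of_smoothForm hKS)
    d hd E₀ ψ₀ hE hψ

/-- **`stub_pad4_carrier` of crux `BlochSeedDiscThree` (item 18882, `d = 3`) MODULO THE SMOOTH FORM of Kleiman's statement**, in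
that stub's own signature. [cite: Kleiman1969Grassmannians, §5] [cite: Schoen1998HodgeWeilAddendum, §10] -/
theorem stub_pad4_carrier_discThree_of_kleimanSmoothForm
    (E₀ : AbelianVariety ℂ) (ψ₀ : E₀ ⟶ E₀) (hE : E₀.dim = 1) (hψ : ψ₀ ≫ ψ₀ = -(3 • 𝟙 E₀)) :
    ∃ (e : ProjectiveEmbedding (pad4Anchor E₀).X) (a : complexBetti (projectiveSpace e.n ℂ) 2)
      (w : complexBetti (pad4Anchor E₀).X (2 * 4)),
      IsRationalClass a ∧ a ≠ 0 ∧
      w ∈ weilClassesOf (pad4Anchor E₀) (pad4Action E₀ ψ₀) 4 3 ∧ IsRationalClass w ∧ w ≠ 0 ∧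
      HasLciCarrierAt 4 (pad4Anchor E₀) (symH 3 (pad4Action E₀ ψ₀) e a) w :=
  stub_pad4_carrier_discThree_of_kleimanSmoothing (kleiman1969_smoothingCycles_eightfold_codimFour_of_smoothForm hKS)
    E₀ ψ₀ hE hψ

end SmoothForm

end Summit.HodgeConjecture.HodgeConjecture.Theorems

end
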